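/-
Copyright (c) 2026 the pub-hodgecm-mathlib formalisation cell (harness21).  Prover seat hodgecm-mathlib-LH4-p19 (g3), req620 Track A «(D-RAM) FOUR-FRAME» squad
(STAGE-1b, row (2) of the piece `f_{T₊}`, the (β₂) road (R-36) «PURE-CELL LEDGER»; β₂ WORD #29∕#31 «p19: RAY BANDS» — the line-model letters of an upper-line cell: the CENTRE
of the cell and the two smallness letters of the root regime), 2026-09-05.
-/
import Summits.HodgeConjecture.HodgeConjecture.Theorems.F0P3cDyRamRayScalarNearlyFixed     -- ★ p863048 (LH4-p16 (g2)): `theta_depth_mul`; brings ★ DEFS, the line-model vocabulary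
import Literature.NumberTheory.LocalFields.WildQuadraticEisensteinFrame                     -- ★ Lit: `exists_fixed_coords_of_map_ne` (Eisenstein coordinates `z = a + b·ϖ`)
import HarnessLib

/-!
# Crux `H413`, line LH4 «(D-RAM) FOUR-FRAME» — STAGE-1b, row (2), the (β₂) road (R-36), (OFF) residue, RAY bands: «THE CENTRE OF A CONE CELL» — `Tr_ρ(μ·κ̂) = (μ − ρμ)·(κ̂ − κ_c)`
# with `κ_c = ρμ∕(ρμ − μ)` on the line `Tr_ρ = 1`; `Θκ_c = κ_c·lam∕u₀₀` and `Θ(μ − ρμ) = −(μ − ρμ)∕(lam·ρlam)` — the ROOT and SLOPE letters of the root-regime dictionary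

Cell `hodgecm-mathlib` (D-0151), FLOOR 0, crux item H413 = `stmt-HodgeConjecture-24833`, route of record `HCCMUnconditional`; squad F0∕P3c∕LH4; lane
`--supports stmt-HodgeConjecture-24833 --as helper` (count-neutral; pays NO tier-0 row).  THEOREMS ONLY (no `def`, no instance, no notation, no `sorry`, default heartbeats);
★-only imports; states NO law; (β₂) stays a HYPOTHESIS.  DATUM-FREE: §0 is `E`-side (an involution `σ` and an element `ϖ` it moves); §1–§3 are ring ∕ valuation algebra on ★ (C1)'s
line model `(M, jE, ρ, Θ; lam, u₀₀)` (`ρ`, `Θ` commuting involutions, `Θlam·lam = 1`, `u₀₀·σu₀₀ = 1`, `Θ∘jE = jE∘σ`), ANY lane.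

WHY (this seat's RAYBANDS census A∕B; β₂ WORD #29 «p19: RAY BANDS»; LH4-p16 (g2) MECH-K3 §1, ★ p862871, ★ p863048 §1).  A vertex `Λ = x₀·𝒪_j` of a cone cell has the
trace-normalised invariant `κ̂ = ρu₀∕t` on the line `{Tr_ρ = 1}` (`u₀ = h·N_Θx₀`, `t = Tr_ρ u₀`; ★ p862871: `κ̂ = D₀⁻¹(jE pw)⁻¹ = κ₀ + jE(V)·ξ₀`), and BOTH of its census
readings are functions of the ONE quantity `Tr_ρ(μ·κ̂)`: the depth ∕ level tokens (`IsOrd cc (μ∕(ϖE^ℓ·Y))`, LH4-p12 (g9) `…UpperLineRayLetters`) and the ray scalar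
(`jE e₀ = Tr_ρ(μ∕D₀) = jE(pw)·Tr_ρ(μκ̂)`).  §1 shows that `Tr_ρ(μ·κ)` is LINEAR along the line with a ROOT ON THE LINE: `Tr_ρ(μκ) = (μ − ρμ)(κ − κ_c)`, `κ_c := ρμ∕(ρμ − μ)`,
`Tr_ρ κ_c = 1` — the CENTRE of the cell.  Hence `e₀ = pw·B·(V − W)` with `jE B = (μ − ρμ)ξ₀` and `jE(W)·ξ₀ = κ_c − κ₀` (§3): on the live row the centre is far from the cell
(the constant term dominates, ★ K4 ∕ ★ p862927), on the UPPER line (`m < 2b`) it lies INSIDE the cell's digit ball — the depth token is the ball `|V − W| ≤ …` and the exact level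
`ℓ₀` is a sphere around `W` (the root regime of ★ `…RootRegimeAffineLabel`, counted by ★ `…SphereLabelDigits`).  §2 gives the two `Θ`-twists that make that dictionary's
letters CELL-LEVEL facts: `Θκ_c = κ_c·(lam∕jE u₀₀)` (so `|jE(W − σW)|·|ξ₀| = |κ_c|·|μ|`, and `|B|·|κ_c|·|μ| = |μ|²·|ξ₀|`: the ROOT letter is the LOW band `m_c ≤ 2s`) and
`Θ(μ − ρμ) = −(μ − ρμ)∕(lam·ρlam)` (`lam·ρlam = det γ₂` is `|ϖE|^N`-close to `1`: the SLOPE letter is the floor `N ≥ 3d − 2`), and §0 the Eisenstein step `|z − a|·|ϖ|^d = |z − σz|·|ϖ|`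
turning «nearly fixed» into «near a fixed element».
* §0 `exists_fixed_v_sub_mul_eq` (E-side).  §1 `centre_add_map_centre`, `trace_mul_eq_skew_mul_sub_centre`, `v_centre_eq`.  §2 `map_centre_eq`, `map_centre_sub_centre`,
  `map_skew_eq_neg_div`.  §3 `exists_centre_coord` (`∃ W : E, jE W·ξ₀ = κ_c − κ₀`), `map_centre_coord_sub` (`jE(W − σW)·ξ₀ = κ_c − Θκ_c`), `trace_div_cellScalar_eq_root`
  (`Tr_ρ(μ∕D₀) = jE pw·((μ − ρμ)ξ₀)·jE(V − W)`), `v_skew_mul_centre_defect` (`|(μ − ρμ)ξ₀|·(|κ_c|·|μ|) = |μ|²·|ξ₀|`).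
WHAT IS NOT CLAIMED: the exponent bookkeeping of a cell (the assembler's), the dictionary (★ `…RootRegimeAffineLabel`), any count.
HONEST LABEL.  Count-neutral ring ∕ valuation algebra; nothing printed is asserted; no census law is stated; `hU_ray`, `hD_ray`, `hL_ray` stay OPEN; `HC_CM` is proved only modulo
the 7 printed citations (2 remaining named inputs: hLiu418 = `stmt-HodgeConjecture-24832`, h413 = `stmt-HodgeConjecture-24833`) until rung 0 closes.
## References
* [Serre1979] J.-P. Serre, *Local Fields*, GTM 67 (1979): Ch. I §6 Prop. 18 (Eisenstein bases), Ch. III §3 Prop. 7 (trace), Ch. III §6 Prop. 12 (orders of conductor `c`).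
* [Jacobowitz1962] R. Jacobowitz, *Hermitian forms over local fields*, Amer. J. Math. 84 (1962): §4 (duals, gluing).
* [Kottwitz1986BaseChangeUnits] R. E. Kottwitz, *Base change for unit elements of Hecke algebras*, Compositio Math. 60 (1986): §1 pp. 240–241.
* [Rogawski1990] J. D. Rogawski, *Automorphic Representations of Unitary Groups in Three Variables*, Ann. of Math. Stud. 123 (1990): §4.9 Prop. 4.9.1 (b) p. 55.
-/

set_option autoImplicit false

noncomputable section

namespace Summit.HodgeConjecture.HodgeConjecture.Cruxes.H413.F0P3cDyRamUpperLineCellCentre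

open scoped Valued WithZero
open WithZero
open Literature.NumberTheory.LocalFields (exists_fixed_coords_of_map_ne)
open Summit.HodgeConjecture.HodgeConjecture.Cruxes.H413.F0P3cDyRamRayScalarNearlyFixed (theta_depth_mul)

variable {E M : Type} [Field E] [Valued E ℤᵐ⁰] [Field M] [Valued M ℤᵐ⁰] {ρ Θ : M →+* M}

/-! ## §0 The Eisenstein step on `E`: nearly fixed ⟹ near a fixed element -/

/-- **NEARLY FIXED ⟹ NEAR A FIXED ELEMENT (Eisenstein step)**: for an involution `σ` of `E` moving `ϖ`, every `z` has a `σ`-fixed `a` with `|z − a|·|ϖ − σϖ| = |z − σz|·|ϖ|`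
(`z = a + b·ϖ` with `a, b` fixed, ★ `exists_fixed_coords_of_map_ne`; `z − σz = b·(ϖ − σϖ)`).  At a sheet datum `|ϖ − σϖ| = |ϖ|^d`, so `|z − a| = |z − σz|·|ϖ|^{1−d}`.
[cite: Serre1979, Ch. I §6 Prop. 18] -/
theorem exists_fixed_v_sub_mul_eq {σ : E →+* E} (hσσ : ∀ x, σ (σ x) = x) {ϖ : E} (hϖσ : σ ϖ ≠ ϖ) (z : E) :
    ∃ a : E, σ a = a ∧ Valued.v (z - a) * Valued.v (ϖ - σ ϖ) = Valued.v (z - σ z) * Valued.v ϖ := by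
  obtain ⟨a, b, ha, hb, hz⟩ := exists_fixed_coords_of_map_ne hσσ hϖσ z
  refine ⟨a, ha, ?_⟩
  have h1 : z - a = b * ϖ := by rw [hz]; ring
  have h2 : z - σ z = b * (ϖ - σ ϖ) := by rw [hz, map_add, map_mul, ha, hb]; ring
  rw [h1, h2, Valuation.map_mul, Valuation.map_mul]
  exact mul_right_comm _ _ _

/-! ## §1 The centre of the line `Tr_ρ = 1` for the multiplier `μ` -/

omit [Valued M ℤᵐ⁰] in
/-- **THE CENTRE LIES ON THE LINE**: `ρ` an involution, `ρμ ≠ μ` ⟹ `Tr_ρ(ρμ∕(ρμ − μ)) = 1`. [cite: Serre1979, Ch. III §3 Prop. 7] -/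
theorem centre_add_map_centre (hρρ : ∀ x, ρ (ρ x) = x) {μ : M} (hμ : ρ μ ≠ μ) :
    ρ μ / (ρ μ - μ) + ρ (ρ μ / (ρ μ - μ)) = 1 := by
  have h0 : ρ μ - μ ≠ 0 := sub_ne_zero.2 hμ
  have h0' : μ - ρ μ ≠ 0 := sub_ne_zero.2 (Ne.symm hμ)
  rw [map_div₀, map_sub, hρρ]
  field_simp
  ring

omit [Valued M ℤᵐ⁰] in
/-- **`Tr_ρ(μ·κ)` IS LINEAR ALONG THE LINE WITH ROOT THE CENTRE**: `Tr_ρ κ = 1`, `ρμ ≠ μ` ⟹ `μκ + ρ(μκ) = (μ − ρμ)·(κ − ρμ∕(ρμ − μ))`. [cite: Serre1979, Ch. III §3 Prop. 7] -/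
theorem trace_mul_eq_skew_mul_sub_centre (hρρ : ∀ x, ρ (ρ x) = x) {μ κ : M} (hκ : κ + ρ κ = 1) (hμ : ρ μ ≠ μ) :
    μ * κ + ρ (μ * κ) = (μ - ρ μ) * (κ - ρ μ / (ρ μ - μ)) := by
  have h0 : ρ μ - μ ≠ 0 := sub_ne_zero.2 hμ
  have hρκ : ρ κ = 1 - κ := by linear_combination hκ
  have _ := hρρ μ
  rw [map_mul, hρκ]
  field_simp
  ring

/-- **THE SIZE OF THE CENTRE**: `|ρμ∕(ρμ − μ)| = |μ| ∕ |μ − ρμ|` (`ρ` isometric). [cite: Serre1979, Ch. III §3 Prop. 7] -/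
theorem v_centre_eq (hvρ : ∀ x, Valued.v (ρ x) = Valued.v x) (μ : M) :
    Valued.v (ρ μ / (ρ μ - μ)) = Valued.v μ / Valued.v (μ - ρ μ) := by
  rw [map_div₀, hvρ, ← neg_sub, Valuation.map_neg]

/-! ## §2 The two `Θ`-twists of the line model -/

omit [Valued E ℤᵐ⁰] [Valued M ℤᵐ⁰] in
/-- **THE CENTRE UNDER `Θ`**: `Θlam·lam = 1`, `u·σu = 1`, `Θ∘jE = jE∘σ`, `Θρ = ρΘ`, `μ = lam − jE u`, `ρμ ≠ μ` ⟹ `Θ(ρμ∕(ρμ − μ)) = ρμ∕(ρμ − μ)·(lam∕jE u)`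
(`Θμ = −μ∕(lam·jE u)`, ★ `theta_depth_mul`; `ρμ·lam − μ·ρlam = jE u·(ρμ − μ)`). [cite: Rogawski1990, §4.9 Prop. 4.9.1 (b) p. 55] [cite: Jacobowitz1962, §4] -/
theorem map_centre_eq (σ : E →+* E) (jE : E →+* M) (hΘj : ∀ c, Θ (jE c) = jE (σ c)) (hρj : ∀ c, ρ (jE c) = jE c) (hΘρ : ∀ x, Θ (ρ x) = ρ (Θ x))
    {lam : M} {u : E} (hΘlam : Θ lam * lam = 1) (huu : u * σ u = 1) (hμ : ρ (lam - jE u) ≠ lam - jE u) :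
    Θ (ρ (lam - jE u) / (ρ (lam - jE u) - (lam - jE u))) = ρ (lam - jE u) / (ρ (lam - jE u) - (lam - jE u)) * (lam / jE u) := by
  have hlam0 : lam ≠ 0 := fun h0 => by rw [h0, mul_zero] at hΘlam; exact zero_ne_one hΘlam
  have hu0 : u ≠ 0 := fun h0 => by rw [h0, zero_mul] at huu; exact zero_ne_one huu
  have hju0 : jE u ≠ 0 := (map_ne_zero jE).2 hu0
  have hρlam0 : ρ lam ≠ 0 := (map_ne_zero ρ).2 hlam0
  have h0 : ρ (lam - jE u) - (lam - jE u) ≠ 0 := sub_ne_zero.2 hμ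
  -- `Θμ = −μ∕(lam·jE u)` and its `ρ`-conjugate
  have hΘμ : Θ (lam - jE u) = -(lam - jE u) / (lam * jE u) := eq_div_of_mul_eq (mul_ne_zero hlam0 hju0) (theta_depth_mul σ jE hΘj hΘlam huu)
  have hΘρμ : Θ (ρ (lam - jE u)) = -(ρ (lam - jE u)) / (ρ lam * jE u) := by
    rw [hΘρ, hΘμ, map_div₀, map_neg, map_mul, hρj]
  have hρμ : ρ (lam - jE u) = ρ lam - jE u := by rw [map_sub, hρj]
  rw [map_div₀, map_sub Θ, hΘρμ, hΘμ, hρμ]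
  rw [hρμ] at h0
  -- the denominator: `−A∕(ρlam·u) + B∕(lam·u) = −u(A − B)∕(lam·ρlam·u)` with `A·lam − B·ρlam = u(A − B)`
  have hden : -(ρ lam - jE u) / (ρ lam * jE u) - -(lam - jE u) / (lam * jE u) = -((ρ lam - jE u) - (lam - jE u)) / (lam * ρ lam) := by
    field_simp
    ring
  rw [hden]
  field_simp

omit [Valued E ℤᵐ⁰] [Valued M ℤᵐ⁰] in
/-- **THE `Θ`-DEFECT OF THE CENTRE**: same letters ⟹ `Θκ_c − κ_c = κ_c·((lam − jE u)∕jE u)`, `κ_c = ρμ∕(ρμ − μ)`. [cite: Rogawski1990, §4.9 Prop. 4.9.1 (b) p. 55] -/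
theorem map_centre_sub_centre (σ : E →+* E) (jE : E →+* M) (hΘj : ∀ c, Θ (jE c) = jE (σ c)) (hρj : ∀ c, ρ (jE c) = jE c) (hΘρ : ∀ x, Θ (ρ x) = ρ (Θ x))
    {lam : M} {u : E} (hΘlam : Θ lam * lam = 1) (huu : u * σ u = 1) (hμ : ρ (lam - jE u) ≠ lam - jE u) :
    Θ (ρ (lam - jE u) / (ρ (lam - jE u) - (lam - jE u))) - ρ (lam - jE u) / (ρ (lam - jE u) - (lam - jE u)) =
      ρ (lam - jE u) / (ρ (lam - jE u) - (lam - jE u)) * ((lam - jE u) / jE u) := by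
  have hu0 : u ≠ 0 := fun h0 => by rw [h0, zero_mul] at huu; exact zero_ne_one huu
  have hju0 : jE u ≠ 0 := (map_ne_zero jE).2 hu0
  rw [map_centre_eq σ jE hΘj hρj hΘρ hΘlam huu hμ]
  field_simp

omit [Valued E ℤᵐ⁰] [Valued M ℤᵐ⁰] in
/-- **THE SKEW OF THE MULTIPLIER UNDER `Θ`**: same letters ⟹ `Θ(μ − ρμ) = −(μ − ρμ)∕(lam·ρlam)` (`lam·ρlam = jE(det γ₂)`). [cite: Rogawski1990, §4.9 Prop. 4.9.1 (b) p. 55] -/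
theorem map_skew_eq_neg_div (σ : E →+* E) (jE : E →+* M) (hΘj : ∀ c, Θ (jE c) = jE (σ c)) (hρj : ∀ c, ρ (jE c) = jE c) (hΘρ : ∀ x, Θ (ρ x) = ρ (Θ x))
    {lam : M} {u : E} (hΘlam : Θ lam * lam = 1) (huu : u * σ u = 1) :
    Θ ((lam - jE u) - ρ (lam - jE u)) = -((lam - jE u) - ρ (lam - jE u)) / (lam * ρ lam) := by
  have hlam0 : lam ≠ 0 := fun h0 => by rw [h0, mul_zero] at hΘlam; exact zero_ne_one hΘlam
  have hu0 : u ≠ 0 := fun h0 => by rw [h0, zero_mul] at huu; exact zero_ne_one huu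
  have hju0 : jE u ≠ 0 := (map_ne_zero jE).2 hu0
  have hρlam0 : ρ lam ≠ 0 := (map_ne_zero ρ).2 hlam0
  have hΘμ : Θ (lam - jE u) = -(lam - jE u) / (lam * jE u) := eq_div_of_mul_eq (mul_ne_zero hlam0 hju0) (theta_depth_mul σ jE hΘj hΘlam huu)
  have hΘρμ : Θ (ρ (lam - jE u)) = -(ρ (lam - jE u)) / (ρ lam * jE u) := by
    rw [hΘρ, hΘμ, map_div₀, map_neg, map_mul, hρj]
  rw [map_sub Θ, hΘμ, hΘρμ, map_sub ρ, hρj]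
  field_simp
  ring

/-! ## §3 The coordinate of the centre, the ray scalar in root form, the size identity -/

omit [Valued E ℤᵐ⁰] [Valued M ℤᵐ⁰] in
/-- **THE CENTRE HAS A COORDINATE**: for a reference pair `κ₀` (`Tr_ρ κ₀ = 1`), `ξ₀` (`ρξ₀ = −ξ₀ ≠ 0`) and `Fix ρ = jE(E)`: `∃ W : E, jE W·ξ₀ = κ_c − κ₀` (two elements of trace `1`
differ by an anti element). [cite: Serre1979, Ch. III §6 Prop. 12] -/
theorem exists_centre_coord (jE : E →+* M) (hjfix : ∀ z, ρ z = z ↔ ∃ c, jE c = z) (hρρ : ∀ x, ρ (ρ x) = x)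
    {μ κ₀ ξ₀ : M} (hμ : ρ μ ≠ μ) (hκ₀ : κ₀ + ρ κ₀ = 1) (hξ : ρ ξ₀ = -ξ₀) (hξ0 : ξ₀ ≠ 0) :
    ∃ W : E, jE W * ξ₀ = ρ μ / (ρ μ - μ) - κ₀ := by
  have hc := centre_add_map_centre hρρ hμ
  have hfix : ρ ((ρ μ / (ρ μ - μ) - κ₀) / ξ₀) = (ρ μ / (ρ μ - μ) - κ₀) / ξ₀ := by
    have h1 : ρ (ρ μ / (ρ μ - μ)) = 1 - ρ μ / (ρ μ - μ) := by linear_combination hc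
    have h2 : ρ κ₀ = 1 - κ₀ := by linear_combination hκ₀
    rw [map_div₀, map_sub, h1, h2, hξ, div_neg]
    ring
  obtain ⟨W, hW⟩ := (hjfix _).1 hfix
  exact ⟨W, by rw [hW, div_mul_cancel₀ _ hξ0]⟩

omit [Valued E ℤᵐ⁰] [Valued M ℤᵐ⁰] in
/-- **THE FIXED DEFECT OF THE CENTRE'S COORDINATE**: `Θ∘jE = jE∘σ`, `Θξ₀ = ξ₀`, `Θκ₀ = κ₀`, `jE W·ξ₀ = κ_c − κ₀` ⟹ `jE(W − σW)·ξ₀ = κ_c − Θκ_c`. [cite: Serre1979, Ch. III §6 Prop. 12] -/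
theorem map_centre_coord_sub (σ : E →+* E) (jE : E →+* M) (hΘj : ∀ c, Θ (jE c) = jE (σ c))
    {κc κ₀ ξ₀ : M} {W : E} (hΘκ₀ : Θ κ₀ = κ₀) (hΘξ : Θ ξ₀ = ξ₀) (hW : jE W * ξ₀ = κc - κ₀) :
    jE (W - σ W) * ξ₀ = κc - Θ κc := by
  have h1 : Θ (jE W * ξ₀) = Θ κc - κ₀ := by rw [hW, map_sub, hΘκ₀]
  rw [map_mul, hΘj, hΘξ] at h1
  rw [map_sub, sub_mul, h1, hW]
  ring

omit [Valued E ℤᵐ⁰] [Valued M ℤᵐ⁰] in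
/-- **THE RAY SCALAR IN ROOT FORM**: with the glue letter `D₀⁻¹ + ρD₀⁻¹ = jE pw`, the coordinate `D₀⁻¹·(jE pw)⁻¹ = κ₀ + jE V·ξ₀` (★ p862871) and the centre's coordinate
`jE W·ξ₀ = κ_c − κ₀`: `Tr_ρ(μ∕D₀) = jE pw·((μ − ρμ)·ξ₀)·jE(V − W)` — the upper-line form of ★ `rayScalar_eq_affine` (`e₀ = pw·B·(V − W)`, `jE B = (μ − ρμ)ξ₀`).
[cite: Jacobowitz1962, §4] [cite: Kottwitz1986BaseChangeUnits, §1 pp. 240–241] [cite: Rogawski1990, §4.9 Prop. 4.9.1 (b) p. 55] -/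
theorem trace_div_cellScalar_eq_root (jE : E →+* M) (hρj : ∀ c, ρ (jE c) = jE c) (hρρ : ∀ x, ρ (ρ x) = x)
    {D₀ μ κ₀ ξ₀ : M} {pw V W : E} (hTr : D₀⁻¹ + ρ D₀⁻¹ = jE pw) (hpw : pw ≠ 0)
    (hκ : D₀⁻¹ * (jE pw)⁻¹ = κ₀ + jE V * ξ₀) (hμ : ρ μ ≠ μ) (hW : jE W * ξ₀ = ρ μ / (ρ μ - μ) - κ₀) :
    μ / D₀ + ρ (μ / D₀) = jE pw * ((μ - ρ μ) * ξ₀) * jE (V - W) := by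
  have hj0 : jE pw ≠ 0 := (map_ne_zero jE).2 hpw
  -- `κ̂ := D₀⁻¹(jE pw)⁻¹` has trace `1`
  have hinv : D₀⁻¹ = (κ₀ + jE V * ξ₀) * jE pw := by rw [← hκ, inv_mul_cancel_right₀ hj0]
  have hκtr : (κ₀ + jE V * ξ₀) + ρ (κ₀ + jE V * ξ₀) = 1 := by
    have h1 : (D₀⁻¹ * (jE pw)⁻¹) + ρ (D₀⁻¹ * (jE pw)⁻¹) = 1 := by
      rw [map_mul, map_inv₀ ρ (jE pw), hρj, ← add_mul, hTr, mul_inv_cancel₀ hj0]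
    rwa [hκ] at h1
  have htr := trace_mul_eq_skew_mul_sub_centre hρρ (μ := μ) hκtr hμ
  have e1 : μ / D₀ = jE pw * (μ * (κ₀ + jE V * ξ₀)) := by rw [div_eq_mul_inv, hinv]; ring
  have e2 : κ₀ + jE V * ξ₀ - ρ μ / (ρ μ - μ) = (jE V - jE W) * ξ₀ := by rw [sub_mul, hW]; ring
  rw [e1, map_mul ρ (jE pw), hρj, ← mul_add, htr, map_sub jE, e2]
  ring

/-- **THE SIZE IDENTITY OF THE ROOT LETTER**: `ρ` isometric ⟹ `|(μ − ρμ)·ξ₀| · (|ρμ∕(ρμ − μ)| · |μ|) = |μ|²·|ξ₀|` — slope × (centre × multiplier): the assembler reads the ROOT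
letter of ★ `…RootRegimeAffineLabel` as `|μ|² ≤ |P·t₊|·|ϖ|^{(2d−1)+(d−1)}`, i.e. the LOW band `m_c ≤ 2s`. [cite: Serre1979, Ch. III §3 Prop. 7] -/
theorem v_skew_mul_centre_defect (hvρ : ∀ x, Valued.v (ρ x) = Valued.v x) {μ : M} (hμ : ρ μ ≠ μ) (ξ₀ : M) :
    Valued.v ((μ - ρ μ) * ξ₀) * (Valued.v (ρ μ / (ρ μ - μ)) * Valued.v μ) = Valued.v μ ^ 2 * Valued.v ξ₀ := by
  have h0 : Valued.v (μ - ρ μ) ≠ 0 := (Valuation.ne_zero_iff _).2 (sub_ne_zero.2 (Ne.symm hμ))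
  rw [v_centre_eq hvρ μ, Valuation.map_mul]
  field_simp

end Summit.HodgeConjecture.HodgeConjecture.Cruxes.H413.F0P3cDyRamUpperLineCellCentre

end
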